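import Literature.NumberTheory.Rogawski1990.ArchEndoscopicCentralCurveGSide        -- ★ p841608 (3G) MAIN (F0P3a-p05 (g11)): `exists_flat_gSide_centralCurve` modulo `hO`
import Literature.NumberTheory.Automorphic.ArchTorusOrbitalDefinitePlaceSmooth     -- (3G-b) `N`-general (this seat): `contDiff_one_integral_comp_conj_archDiagTorus_curve_of_posDef`
import Literature.NumberTheory.Rogawski1990.ArchSmoothAmbientLift                  -- ★ p841442 (3A) (F0P3a-p02 (g10)): `ArchSmooth.exists_contDiff` (letters' `C_c^∞` ⟶ ambient `Θ`)
import HarnessLib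

/-!
# Lemma 14.5.2 (c) at `∞`: the relabelled orbital integrals along the central curve are differentiable through the centre with bounded derivative — the discharge of `hO`
# (Rogawski 1990 §14.5 p. 238 «at `v ∈ S₀` …»; §8.2–8.3)

Topic `NumberTheory/Rogawski1990`; namespace `Literature.NumberTheory.Rogawski1990`.  THEOREMS ONLY (no definition, no named fact, no instance, no notation, no `sorry`).
Cell `pub/hodgecm-mathlib`, ENGINE T1 (crux H413 = `stmt-HodgeConjecture-24833`); floor-1½ preparation, count-neutral, under row (S-c) ∕ `stub_ScCore` of the «SdArch» pay-down line:
brick **(3G-b) «ORBITAL SMOOTHNESS»** = the discharge of the hypothesis `hO` of ★ (3G) `exists_flat_gSide_centralCurve` (LEAD F0P3a-plan (g9) WORD T8-84 (1); consumer: the 3Z assembly of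
`stub_ScCore`, NODE 3G; author F0P3a-p05 (g12)).

THE MATHEMATICS.  In the frame of ★ (3G) (`H′ = diag α`, `α_i ≠ 0`; the curve `z(ψ)_w = (z₀_{w,i} e^{i k_i c_w ψ})_i`, `k = (1, 0, −1)`, moving ONLY at `w₀` (`c_w = 0` for `w ≠ w₀`) and regular
at the places `w ≠ w₀`) assume moreover that `w₀` is a DEFINITE place of `diag α` (Rogawski's `v ∈ S₀`: `G′_{w₀} = U(3)` compact), that `ν′` is a Haar measure on `G′_∞` and that `a′` is a
genuine test function (`ArchSmooth`: the restriction of an ambient smooth compactly supported `Θ`, ★ `ArchSmooth.exists_contDiff`).  Then for every relabelling `ρ : W → S₃` the orbital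
integral `O_ρ(ψ) = ∫_{G′_∞} a′(g · t(z(ψ)∘ρ) · g⁻¹) dν′(g)` is `C¹` on all of `ℝ` — differentiable at EVERY `ψ` near `0`, the centre included — with `O_ρ`, `O_ρ′` bounded near `0`:
★ `contDiff_one_integral_comp_conj_archDiagTorus_curve_of_posDef` (Haar `= χ • e⁻¹_* ⊗haar_w`, Fubini at the compact place, ONE smooth partial orbital test function `Θ′` on `M₃(ℂ)` for the
whole curve, differentiation under `∫_{U(3)}` ★ A-p18) at the relabelled data `z₀_w ∘ ρ_w` (regular off `w₀`), `ζ = z₀_{w₀} ∘ ρ_{w₀}`, angular speeds `k_{ρ_{w₀} i} c_{w₀}`.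
* §1 `differentiableAt_orbital_centralCurve_relabel_of_contDiff` — the `hO` clause of ★ (3G) for ONE `ρ`, TOKEN FOR TOKEN, from the ambient `Θ`; `…_of_archSmooth` — the same from `ArchSmooth L 3 (diag α) a′`.
* §2 **`exists_flat_gSide_centralCurve_of_archSmooth`** — ★ (3G)'s head with `hO` DISCHARGED: hypotheses `[ν′.IsHaarMeasure]`, `hpos` (definite `w₀`), `ArchSmooth L 3 (diag α) a′` instead.
HONEST LABEL: HC_CM is proved only modulo the printed citations until rung 0 closes; calculus plumbing, pays nothing by itself.

## References
* [Rogawski1990] J. D. Rogawski, *Automorphic Representations of Unitary Groups in Three Variables*, Ann. of Math. Stud. 123 (1990): §14.5 Lemma 14.5.2 (c), p. 238; §8.2 pp. 122–124; §8.3 p. 122.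
* [BorelJacquet1979] A. Borel, H. Jacquet, *Automorphic forms and automorphic representations*, PSPM 33.1 (1979), §4.1.
* [Folland1995] G. B. Folland, *A Course in Abstract Harmonic Analysis* (1995), §2.2 Thm. 2.20, §2.6.
-/

set_option autoImplicit false

noncomputable section

open NumberField NumberField.InfinitePlace NumberField.mixedEmbedding Matrix Filter Topology Equiv MeasureTheory
open scoped MatrixGroups Real ComplexOrder ContDiff

namespace Literature.NumberTheory.Rogawski1990

open Literature.NumberTheory.Automorphic
open Literature.NumberTheory.GaloisRepresentations

-- the scoped `L^∞`-operator norm on `M_N(L ⊗ ℝ)`, the cell's ambient-smooth convention (★ `ArchimedeanCalculus`)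
open scoped Matrix.Norms.Operator

/-! ## §1 The `hO` clause of ★ (3G), one relabelling at a time -/

section Orbital

variable (L : Type) [Field L] [NumberField L] [IsCMField L] (α : Fin 3 → L)
  (z₀ : {w : InfinitePlace L // IsComplex w} → Fin 3 → Circle) (c : {w : InfinitePlace L // IsComplex w} → ℝ) (w₀ : {w : InfinitePlace L // IsComplex w})
  [MeasurableSpace ↥(UnitaryGroup.arch (↥(maximalRealSubfield L)) L (IsCMField.complexConj L) 3 (Matrix.diagonal α))] [BorelSpace ↥(UnitaryGroup.arch (↥(maximalRealSubfield L)) L (IsCMField.complexConj L) 3 (Matrix.diagonal α))]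
  (ν' : Measure ↥(UnitaryGroup.arch (↥(maximalRealSubfield L)) L (IsCMField.complexConj L) 3 (Matrix.diagonal α))) [ν'.IsHaarMeasure]
  (a' : ↥(UnitaryGroup.arch (↥(maximalRealSubfield L)) L (IsCMField.complexConj L) 3 (Matrix.diagonal α)) → ℂ)

open scoped Classical in
/-- **(3G-b) FROM THE AMBIENT `Θ`**: the `hO` clause of ★ `exists_flat_gSide_centralCurve` for ONE relabelling `ρ`, token for token — `O_ρ` differentiable at every `ψ` near `0` (the centre
included) with `‖O_ρ‖, ‖O_ρ′‖ ≤ M` near `0` — for `a′ = Θ ∘ ↑↑·` with `Θ : M₃(L ⊗ ℝ) → ℂ` smooth and compactly supported on `G′_∞`, `ν′` Haar, `w₀` definite, `c_w = 0` and `z₀_w` regular off `w₀`.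
[cite: Rogawski1990, §14.5 Lemma 14.5.2 (c), p. 238; §8.2 pp. 122–123] [cite: Folland1995, §2.6] -/
theorem differentiableAt_orbital_centralCurve_relabel_of_contDiff (hα : ∀ i, α i ≠ 0) (hc : ∀ w, w ≠ w₀ → c w = 0) (hinj : ∀ w, w ≠ w₀ → Function.Injective (z₀ w))
    (hpos : ((Matrix.diagonal α).map (w₀.1.embedding : L →+* ℂ)).PosDef ∨ (-((Matrix.diagonal α).map (w₀.1.embedding : L →+* ℂ))).PosDef)
    (Θ : Matrix (Fin 3) (Fin 3) (mixedSpace L) → ℂ) (hΘ : ContDiff ℝ (⊤ : ℕ∞) Θ)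
    (hΘc : HasCompactSupport fun g : UnitaryGroup.arch (↥(maximalRealSubfield L)) L (IsCMField.complexConj L) 3 (Matrix.diagonal α) =>
      Θ ((g : GL (Fin 3) (mixedSpace L)) : Matrix (Fin 3) (Fin 3) (mixedSpace L)))
    (ha' : ∀ k, a' k = Θ ((k : GL (Fin 3) (mixedSpace L)) : Matrix (Fin 3) (Fin 3) (mixedSpace L)))
    (ρ : {w : InfinitePlace L // IsComplex w} → Perm (Fin 3)) :
    (∀ᶠ ψ in 𝓝 (0 : ℝ), DifferentiableAt ℝ (fun ψ : ℝ => ∫ g, a' (g * (UnitaryGroup.archDiagTorus L 3 α fun w => (fun i : Fin 3 => z₀ w i * Circle.exp (![(1 : ℝ), 0, -1] i * (c w * ψ))) ∘ ρ w) * g⁻¹) ∂ν') ψ) ∧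
      ∃ M : ℝ, (∀ᶠ ψ in 𝓝 (0 : ℝ), ‖∫ g, a' (g * (UnitaryGroup.archDiagTorus L 3 α fun w => (fun i : Fin 3 => z₀ w i * Circle.exp (![(1 : ℝ), 0, -1] i * (c w * ψ))) ∘ ρ w) * g⁻¹) ∂ν'‖ ≤ M) ∧
        ∀ᶠ ψ in 𝓝 (0 : ℝ), ‖deriv (fun ψ : ℝ => ∫ g, a' (g * (UnitaryGroup.archDiagTorus L 3 α fun w => (fun i : Fin 3 => z₀ w i * Circle.exp (![(1 : ℝ), 0, -1] i * (c w * ψ))) ∘ ρ w) * g⁻¹) ∂ν') ψ‖ ≤ M := by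
  have e : a' = fun k : UnitaryGroup.arch (↥(maximalRealSubfield L)) L (IsCMField.complexConj L) 3 (Matrix.diagonal α) =>
      Θ ((k : GL (Fin 3) (mixedSpace L)) : Matrix (Fin 3) (Fin 3) (mixedSpace L)) := funext ha'
  subst e
  -- the relabelled data: base point `z₀_w ∘ ρ_w` (regular off `w₀`), `ζ = z₀_{w₀} ∘ ρ_{w₀}`, speeds `k_{ρ_{w₀} i} · c_{w₀}`
  have hz : ∀ w, w ≠ w₀ → Function.Injective (z₀ w ∘ ρ w) := fun w hw => (hinj w hw).comp (ρ w).injective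
  have hγ : ∀ (ψ : ℝ) (w : {w : InfinitePlace L // IsComplex w}), w ≠ w₀ →
      (fun i : Fin 3 => z₀ w i * Circle.exp (![(1 : ℝ), 0, -1] i * (c w * ψ))) ∘ ρ w = z₀ w ∘ ρ w := by
    intro ψ w hw
    funext i
    simp only [Function.comp_apply, hc w hw, zero_mul, mul_zero, Circle.exp_zero, mul_one]
  have hγ₀ : ∀ ψ : ℝ, (fun i : Fin 3 => z₀ w₀ i * Circle.exp (![(1 : ℝ), 0, -1] i * (c w₀ * ψ))) ∘ ρ w₀ =
      fun i : Fin 3 => (z₀ w₀ ∘ ρ w₀) i * Circle.exp ((![(1 : ℝ), 0, -1] (ρ w₀ i) * c w₀) * ψ) := by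
    intro ψ
    funext i
    simp only [Function.comp_apply, mul_assoc]
  obtain ⟨hC, M, hM⟩ := UnitaryGroup.contDiff_one_integral_comp_conj_archDiagTorus_curve_of_posDef L 3 α hα w₀ hpos ν' Θ hΘ hΘc hz (z₀ w₀ ∘ ρ w₀)
    (fun i : Fin 3 => ![(1 : ℝ), 0, -1] (ρ w₀ i) * c w₀)
    (fun (ψ : ℝ) (w : {w : InfinitePlace L // IsComplex w}) => (fun i : Fin 3 => z₀ w i * Circle.exp (![(1 : ℝ), 0, -1] i * (c w * ψ))) ∘ ρ w) hγ hγ₀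
  have hIcc : Set.Icc (-1 : ℝ) 1 ∈ 𝓝 (0 : ℝ) := Icc_mem_nhds (by norm_num) (by norm_num)
  refine ⟨Filter.Eventually.of_forall fun ψ => (hC.differentiable one_ne_zero) ψ, M, ?_, ?_⟩
  · filter_upwards [hIcc] with ψ hψ using (hM ψ hψ).1
  · filter_upwards [hIcc] with ψ hψ using (hM ψ hψ).2

open scoped Classical in
/-- **(3G-b) FROM `ArchSmooth`**: the `hO` clause of ★ `exists_flat_gSide_centralCurve` for ONE relabelling `ρ`, token for token, for a genuine test function `a′` (`ArchSmooth L 3 (diag α) a′`,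
★ `ArchSmooth.exists_contDiff`), `ν′` Haar, `w₀` definite, `c_w = 0` and `z₀_w` regular off `w₀`. [cite: Rogawski1990, §14.5 Lemma 14.5.2 (c), p. 238; §14.2 p. 233] -/
theorem differentiableAt_orbital_centralCurve_relabel_of_archSmooth (hα : ∀ i, α i ≠ 0) (hc : ∀ w, w ≠ w₀ → c w = 0) (hinj : ∀ w, w ≠ w₀ → Function.Injective (z₀ w))
    (hpos : ((Matrix.diagonal α).map (w₀.1.embedding : L →+* ℂ)).PosDef ∨ (-((Matrix.diagonal α).map (w₀.1.embedding : L →+* ℂ))).PosDef)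
    (ha' : ArchSmooth L 3 (Matrix.diagonal α) a') (ρ : {w : InfinitePlace L // IsComplex w} → Perm (Fin 3)) :
    (∀ᶠ ψ in 𝓝 (0 : ℝ), DifferentiableAt ℝ (fun ψ : ℝ => ∫ g, a' (g * (UnitaryGroup.archDiagTorus L 3 α fun w => (fun i : Fin 3 => z₀ w i * Circle.exp (![(1 : ℝ), 0, -1] i * (c w * ψ))) ∘ ρ w) * g⁻¹) ∂ν') ψ) ∧
      ∃ M : ℝ, (∀ᶠ ψ in 𝓝 (0 : ℝ), ‖∫ g, a' (g * (UnitaryGroup.archDiagTorus L 3 α fun w => (fun i : Fin 3 => z₀ w i * Circle.exp (![(1 : ℝ), 0, -1] i * (c w * ψ))) ∘ ρ w) * g⁻¹) ∂ν'‖ ≤ M) ∧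
        ∀ᶠ ψ in 𝓝 (0 : ℝ), ‖deriv (fun ψ : ℝ => ∫ g, a' (g * (UnitaryGroup.archDiagTorus L 3 α fun w => (fun i : Fin 3 => z₀ w i * Circle.exp (![(1 : ℝ), 0, -1] i * (c w * ψ))) ∘ ρ w) * g⁻¹) ∂ν') ψ‖ ≤ M := by
  obtain ⟨Θ, hΘ, -, hΘc, hΘa⟩ := ha'.exists_contDiff
  exact differentiableAt_orbital_centralCurve_relabel_of_contDiff L α z₀ c w₀ ν' a' hα hc hinj hpos Θ hΘ hΘc hΘa ρ

end Orbital

/-! ## §2 ★ (3G)'s head with `hO` discharged -/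

section Head

variable (L : Type) [Field L] [NumberField L] [IsCMField L] (α : Fin 3 → L)
  (z₀ : {w : InfinitePlace L // IsComplex w} → Fin 3 → Circle) (c : {w : InfinitePlace L // IsComplex w} → ℝ)
  (γH : ℝ →
    ↥(UnitaryGroup.arch (↥(maximalRealSubfield L)) L (IsCMField.complexConj L) 2
        (Matrix.of fun i j : Fin 2 => if i.val + j.val + 1 = 2 then (1 : L) else 0)) ×
      ↥(UnitaryGroup.arch (↥(maximalRealSubfield L)) L (IsCMField.complexConj L) 1
        (Matrix.of fun i j : Fin 1 => if i.val + j.val + 1 = 1 then (1 : L) else 0)))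
  (γG : ℝ → ↥(UnitaryGroup.arch (↥(maximalRealSubfield L)) L (IsCMField.complexConj L) 3 (Matrix.diagonal α)))
  (hγH : γH = fun ψ =>
    ((UnitaryGroup.archPiEquivCM 2 L (Matrix.of fun i j : Fin 2 => if i.val + j.val + 1 = 2 then (1 : L) else 0)).symm fun w =>
        ⟨Matrix.GeneralLinearGroup.mkOfDetNeZero !![(1 : ℂ), 1; 1, -1] UnitaryGroup.det_cayleyTwo_ne_zero *
            UnitaryGroup.circleDiagonal 2 ![z₀ w 0 * Circle.exp (![(1 : ℝ), 0, -1] 0 * (c w * ψ)), z₀ w 2 * Circle.exp (![(1 : ℝ), 0, -1] 2 * (c w * ψ))] *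
          (Matrix.GeneralLinearGroup.mkOfDetNeZero !![(1 : ℂ), 1; 1, -1] UnitaryGroup.det_cayleyTwo_ne_zero)⁻¹,
          UnitaryGroup.cayley_conj_circleDiagonal_mem_archLocal L w _⟩,
      (UnitaryGroup.archPiEquivCM 1 L (Matrix.of fun i j : Fin 1 => if i.val + j.val + 1 = 1 then (1 : L) else 0)).symm fun w =>
        ⟨UnitaryGroup.circleDiagonal 1 ![z₀ w 1 * Circle.exp (![(1 : ℝ), 0, -1] 1 * (c w * ψ))],
          UnitaryGroup.circleDiagonal_mem_archLocal_antidiagOne L w _⟩))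
  (hγG : γG = fun ψ => UnitaryGroup.archDiagTorus L 3 α fun w i => z₀ w i * Circle.exp (![(1 : ℝ), 0, -1] i * (c w * ψ)))
  (w₀ : {w : InfinitePlace L // IsComplex w}) (μ : HeckeCharacter L)
  (T : ArchTransferFactor L (Matrix.diagonal α))
  [MeasurableSpace ↥(UnitaryGroup.arch (↥(maximalRealSubfield L)) L (IsCMField.complexConj L) 3 (Matrix.diagonal α))] [BorelSpace ↥(UnitaryGroup.arch (↥(maximalRealSubfield L)) L (IsCMField.complexConj L) 3 (Matrix.diagonal α))]
  (ν' : Measure ↥(UnitaryGroup.arch (↥(maximalRealSubfield L)) L (IsCMField.complexConj L) 3 (Matrix.diagonal α))) [ν'.IsHaarMeasure] [ν'.IsMulRightInvariant]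
  (a' : ↥(UnitaryGroup.arch (↥(maximalRealSubfield L)) L (IsCMField.complexConj L) 3 (Matrix.diagonal α)) → ℂ)

include hγH hγG in
open scoped Classical in
/-- **THE `G′`-SIDE OF (vi) ALONG THE CENTRAL CURVE IS FLAT — `hO` DISCHARGED** (★ (3G) `exists_flat_gSide_centralCurve` + §1): for `ν′` a Haar measure, `a′` a genuine test function
(`ArchSmooth`) and `w₀` a DEFINITE place of `diag α`, there is `r : ℝ → ℂ`, differentiable on a punctured neighbourhood of `0` with `r′ → 0` there, agreeing on a punctured neighbourhood of `0`
with `(2 sin ψ) • Σᶠ_{c′} T.Δ(γ_H(ψ), out c′) · ∫ a′(g·out c′·g⁻¹) dν′`.  The input `heq`∕`hr` of ★ `sum_integral_pi_erase_eq_zero_of_eventuallyEq` on the `G′`-side, NODE 3G of the 3Z assembly.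
[cite: Rogawski1990, §14.5 Lemma 14.5.2 (c), p. 238] -/
theorem exists_flat_gSide_centralCurve_of_archSmooth (hα : ∀ i, α i ≠ 0) (hherm : ∀ i, (IsCMField.complexConj L (α i) : L) = α i)
    (hreal : ∀ (w : {w : InfinitePlace L // IsComplex w}) (i : Fin 3), (w.1.embedding (α i)).im = 0) (hμu : μ.IsUnitary) (cT : ℂ)
    (hT : ∀ a b, T.Δ a b = cT * archExplicitDelta L (Matrix.diagonal α) a μ b)
    (hc₀ : c w₀ ≠ 0) (hc : ∀ w, w ≠ w₀ → c w = 0) (hcen : z₀ w₀ 0 = z₀ w₀ 1 ∧ z₀ w₀ 2 = z₀ w₀ 1) (hinj : ∀ w, w ≠ w₀ → Function.Injective (z₀ w))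
    (hpos : ((Matrix.diagonal α).map (w₀.1.embedding : L →+* ℂ)).PosDef ∨ (-((Matrix.diagonal α).map (w₀.1.embedding : L →+* ℂ))).PosDef)
    (ha' : ArchSmooth L 3 (Matrix.diagonal α) a') :
    ∃ r : ℝ → ℂ, (∀ᶠ ψ in 𝓝[≠] (0 : ℝ), DifferentiableAt ℝ r ψ) ∧ Tendsto (deriv r) (𝓝[≠] 0) (𝓝 0) ∧
      ∀ᶠ ψ in 𝓝[≠] (0 : ℝ), (2 * Real.sin ψ) • ∑ᶠ c' : ConjClasses ↥(UnitaryGroup.arch (↥(maximalRealSubfield L)) L (IsCMField.complexConj L) 3 (Matrix.diagonal α)), T.Δ (γH ψ) (Quotient.out c') * ∫ g, a' (g * Quotient.out c' * g⁻¹) ∂ν' = r ψ :=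
  exists_flat_gSide_centralCurve L α z₀ c γH γG hγH hγG w₀ μ T ν' a' hα hherm hreal hμu cT hT hc₀ hc hcen hinj
    fun ρ => differentiableAt_orbital_centralCurve_relabel_of_archSmooth L α z₀ c w₀ ν' a' hα hc hinj hpos ha' ρ

end Head

end Literature.NumberTheory.Rogawski1990

end
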